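import Mathlib
import Literature.Analysis.Matrix.TridiagonalDeterminant
import Summits.ValiantsHypothesis.ValiantsHypothesis.Theorems.SymmetroidPencilBasics

/-!
# CANCELLATION-BORN positive zeros in the static tridiagonal sector: a `K = 2`, `8 × 8` pencil with TWO positive determinant
# zeros under a FLAT, sign-constant Newton polygon — the «envelope-count» lifting law is false

HONEST FRAMING.  Helper datum (seat val-sym-lift-p2 g8, cell `pub-symmetroid`, 2026-08-27; desk R2114 (A)(a): «type (iii) as a kernel row
first») for the REAL side of the crux `WeakLifting` (stmt-ValiantsHypothesis-19561), static tridiagonal sector.  It is a FIXED-FORMAT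
NEGATIVE datum about a LIFTING MECHANISM (how many real zeros a window of the tropical envelope can carry), not a statement about `WeakLifting`,
`TropicalB`, Conjecture B, the typed α target's linear family, the Door-A registers, `MatrixDescartes` (stmt-ValiantsHypothesis-18050) or
VP ≠ VNP.  Label: calibration (target repair).

WHAT IS PROVED.
* `det_cancellationWitness` — the determinant of the real symmetric TRIDIAGONAL `8 × 8` pencil `T(X) = A + X·B` with `A = diag(6,6,6,−6,−6,6,−6,−6)`
  and `B` symmetric with zero diagonal and off-diagonal `(6,3,6,5,6,3,6)` (a STATIC design of format `(8, 2)`: every entry is ONE monomial,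
  exponent `0` on the diagonal and `1` off it) is `p = 6⁸ − 1166400 X² − 1131408 X⁴ − 1093500 X⁶ + 6⁸ X⁸`, `6⁸ = 1679616` (continuant
  recurrence `Literature.Analysis.Matrix.det_tridiagonal_eq`, unrolled from the lower-right corner).
* `exists_staticTridiagonal_cancellationBorn` — packaged in the monomial-matrix currency of the desk's typed α target (`c`, `e` symmetric,
  `c = 0` off the band `|i − j| ≤ 1`): the determinant `p` has `p.coeff 0 = p.leadingCoeff = 6⁸ > 0`, `p.natDegree = 8`, EVERY OTHER
  coefficient `≤ 0` with modulus `< 6⁸` — so every negative coefficient lies STRICTLY BELOW THE CHORD of the two extreme coefficients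
  (`|p_k|^8 < p_0^{8−k} · lc^k`), the (archimedean) upper Newton polygon is the single FLAT edge `(0, 6⁸)—(8, 6⁸)` with both signs `+`, the
  SIGNED NEWTON-POLYGON COUNT is `0` (two hull points) — and nevertheless `p(1/2) > 0 > p(1) < 0 < p(2)`: at least TWO distinct positive zeros
  (`SymmetroidDescartes.le_card_posRoots_of_alternating`; exactly two by an exact Sturm count, located).  Tropically the design has ONE event
  (`∅ →` the perfect matching) and NO sign alternation; the zeros are born by CANCELLATION among the three sub-dominant negative clusters
  (`25/36 + 97/144 + 125/192 > 2` while each is `< 1` — a Chebyshev-type conspiracy, all off-diagonal rates equal, far from the tropical regime).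
* `not_envelopeCountLaw_one` — hence the law «on static symmetric tridiagonal monomial pencils: (extreme coefficients positive ∧ every negative
  coefficient strictly below the chord) ⇒ at most ONE positive zero» is FALSE; since under that hypothesis no negative coefficient lies on the
  upper Newton polygon, this refutes «real count ≤ signed Newton count + c» for `c = 0, 1` (the `StaticTridiagonalEnvelopeCount` reading of
  lead R2095 (iii)).  LOCATED, NOT CLAIMED HERE: block sums `diag(T(X), T(X⁹), T(X⁸¹), …)` (flat chords add under Minkowski sums of digit-
  separated supports) give `2r` positive zeros against `r + 1` positive hull points — false for EVERY `c`; any true real-vs-tropical law for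
  the sector needs additive slack `Ω(m)` or a factor `≥ 2` on the number of envelope points; with a DEFINITE diagonal and equal rates no excess
  is possible (Heilmann–Lieb).  Exact two-code check: seat folder exp/cancel8/flat_witness.py (matching expansion = Gaussian elimination).
[folklore: continuant recurrence; intermediate value theorem; data of this seat]
-/

set_option linter.dupNamespace false
set_option autoImplicit false

namespace Summit.ValiantsHypothesis.ValiantsHypothesis.Theorems.KPlusLogSqLaw.TridiagonalSector

open Polynomial Finset Matrix

/-! ### Shifted principal blocks of a doubly-indexed family and the continuant recurrence -/

section Shift

variable {R : Type*}

/-- the trailing principal block of a shifted block is the next shifted block. [folklore] -/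
theorem of_shift_submatrix_succ (f : ℕ → ℕ → R) (n s s₁ : ℕ) (h₁ : s₁ = s + 1) :
    (Matrix.of fun i j : Fin (n + 1) => f (s + i) (s + j)).submatrix Fin.succ Fin.succ =
      Matrix.of fun i j : Fin n => f (s₁ + i) (s₁ + j) := by
  ext i j
  simp only [Matrix.submatrix_apply, Matrix.of_apply, Fin.val_succ, h₁]
  congr 1 <;> omega

/-- the same two steps down. [folklore] -/
theorem of_shift_submatrix_succ_succ (f : ℕ → ℕ → R) (n s s₂ : ℕ) (h₂ : s₂ = s + 2) :
    (Matrix.of fun i j : Fin (n + 2) => f (s + i) (s + j)).submatrix (Fin.succ ∘ Fin.succ) (Fin.succ ∘ Fin.succ) =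
      Matrix.of fun i j : Fin n => f (s₂ + i) (s₂ + j) := by
  ext i j
  simp only [Matrix.submatrix_apply, Matrix.of_apply, Function.comp_apply, Fin.val_succ, h₂]
  congr 1 <;> omega

variable [CommRing R]

/-- **continuant recurrence for shifted blocks** of a tridiagonal family `f : ℕ → ℕ → R`:
`det f[s, s+n+2) = f s s · det f[s+1, s+n+2) − f s (s+1) · f (s+1) s · det f[s+2, s+n+2)`
(`Literature.Analysis.Matrix.det_tridiagonal_eq`). [folklore] -/
theorem det_of_shift_succ_succ (f : ℕ → ℕ → R) (hf : ∀ i j : ℕ, i + 1 < j ∨ j + 1 < i → f i j = 0)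
    (n s s₁ s₂ : ℕ) (h₁ : s₁ = s + 1) (h₂ : s₂ = s + 2) :
    (Matrix.of fun i j : Fin (n + 2) => f (s + i) (s + j)).det =
      f s s * (Matrix.of fun i j : Fin (n + 1) => f (s₁ + i) (s₁ + j)).det -
        f s s₁ * f s₁ s * (Matrix.of fun i j : Fin n => f (s₂ + i) (s₂ + j)).det := by
  rw [Literature.Analysis.Matrix.det_tridiagonal_eq _ (fun i j hij => by
    simp only [Matrix.of_apply]; exact hf _ _ (by omega))]
  rw [of_shift_submatrix_succ f (n + 1) s s₁ h₁, of_shift_submatrix_succ_succ f n s s₂ h₂]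
  simp only [Matrix.of_apply, Fin.val_zero, Fin.val_one, add_zero, h₁]

/-- size `0`: determinant `1`. [folklore] -/
theorem det_of_shift_zero (f : ℕ → ℕ → R) (s : ℕ) : (Matrix.of fun i j : Fin 0 => f (s + i) (s + j)).det = 1 :=
  Matrix.det_isEmpty

/-- size `1`: determinant `f s s`. [folklore] -/
theorem det_of_shift_one (f : ℕ → ℕ → R) (s : ℕ) : (Matrix.of fun i j : Fin 1 => f (s + i) (s + j)).det = f s s := by
  rw [Matrix.det_fin_one]; simp

end Shift

/-! ### The witness -/

/-- **the determinant of the witness pencil** `T(X) = A + X·B`, `A = diag(6,6,6,−6,−6,6,−6,−6)`, `B` = symmetric off-diagonal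
`(6,3,6,5,6,3,6)`, written as a matrix of monomials `C (c i j) · X ^ (e i j)`:
`det T(X) = 6⁸ − 1166400 X² − 1131408 X⁴ − 1093500 X⁶ + 6⁸ X⁸`. [folklore: continuant recurrence, unrolled] -/
theorem det_cancellationWitness :
    (Matrix.of fun i j : Fin 8 =>
        C ((if (i : ℕ) = j then (if (i : ℕ) = 3 ∨ (i : ℕ) = 4 ∨ (i : ℕ) = 6 ∨ (i : ℕ) = 7 then (-6 : ℝ) else 6)
            else if (j : ℕ) = i + 1 then (if (i : ℕ) = 1 ∨ (i : ℕ) = 5 then (3 : ℝ) else if (i : ℕ) = 3 then 5 else 6)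
            else if (i : ℕ) = j + 1 then (if (j : ℕ) = 1 ∨ (j : ℕ) = 5 then (3 : ℝ) else if (j : ℕ) = 3 then 5 else 6)
            else 0)) *
          (X : ℝ[X]) ^ (if (i : ℕ) = j then 0 else 1)).det =
      C 1679616 - C 1166400 * X ^ 2 - C 1131408 * X ^ 4 - C 1093500 * X ^ 6 + C 1679616 * X ^ 8 := by
  -- the doubly-indexed family on `ℕ × ℕ`
  let dg : ℕ → ℝ := fun i => if i = 3 ∨ i = 4 ∨ i = 6 ∨ i = 7 then -6 else 6
  let od : ℕ → ℝ := fun i => if i = 1 ∨ i = 5 then 3 else if i = 3 then 5 else 6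
  let f : ℕ → ℕ → ℝ[X] := fun i j =>
    C (if i = j then dg i else if j = i + 1 then od i else if i = j + 1 then od j else 0) * X ^ (if i = j then 0 else 1)
  have hf : ∀ i j : ℕ, i + 1 < j ∨ j + 1 < i → f i j = 0 := by
    intro i j hij
    have h1 : i ≠ j := by omega
    have h2 : j ≠ i + 1 := by omega
    have h3 : i ≠ j + 1 := by omega
    simp only [f, h1, h2, h3, if_false, map_zero, zero_mul]
  -- the matrix of the statement is the block `f[0, 8)`
  have hM : (Matrix.of fun i j : Fin 8 =>
        C ((if (i : ℕ) = j then (if (i : ℕ) = 3 ∨ (i : ℕ) = 4 ∨ (i : ℕ) = 6 ∨ (i : ℕ) = 7 then (-6 : ℝ) else 6)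
            else if (j : ℕ) = i + 1 then (if (i : ℕ) = 1 ∨ (i : ℕ) = 5 then (3 : ℝ) else if (i : ℕ) = 3 then 5 else 6)
            else if (i : ℕ) = j + 1 then (if (j : ℕ) = 1 ∨ (j : ℕ) = 5 then (3 : ℝ) else if (j : ℕ) = 3 then 5 else 6)
            else 0)) *
          (X : ℝ[X]) ^ (if (i : ℕ) = j then 0 else 1)) =
      Matrix.of fun i j : Fin 8 => f (0 + i) (0 + j) := by
    ext i j
    simp only [Matrix.of_apply, zero_add, f, dg, od]
  rw [hM]
  -- entries along the band
  have hdd : ∀ s, f s s = C (dg s) := by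
    intro s; simp only [f, if_true, pow_zero, mul_one]
  have hdo : ∀ s s₁, s₁ = s + 1 → f s s₁ = C (od s) * X := by
    intro s s₁ h; subst h
    have h1 : s ≠ s + 1 := by omega
    simp only [f, h1, if_false, if_true, pow_one]
  have hod : ∀ s s₁, s₁ = s + 1 → f s₁ s = C (od s) * X := by
    intro s s₁ h; subst h
    have h1 : s + 1 ≠ s := by omega
    have h2 : s ≠ s + 1 + 1 := by omega
    simp only [f, h1, h2, if_false, if_true, pow_one]
  -- the letters
  have hdg0 : C (dg 0) = (6 : ℝ[X]) := by simp [dg, map_ofNat]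
  have hdg1 : C (dg 1) = (6 : ℝ[X]) := by simp [dg, map_ofNat]
  have hdg2 : C (dg 2) = (6 : ℝ[X]) := by simp [dg, map_ofNat]
  have hdg3 : C (dg 3) = (-6 : ℝ[X]) := by simp [dg, map_ofNat]
  have hdg4 : C (dg 4) = (-6 : ℝ[X]) := by simp [dg, map_ofNat]
  have hdg5 : C (dg 5) = (6 : ℝ[X]) := by simp [dg, map_ofNat]
  have hdg6 : C (dg 6) = (-6 : ℝ[X]) := by simp [dg, map_ofNat]
  have hdg7 : C (dg 7) = (-6 : ℝ[X]) := by simp [dg, map_ofNat]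
  have hog0 : C (od 0) = (6 : ℝ[X]) := by simp [od, map_ofNat]
  have hog1 : C (od 1) = (3 : ℝ[X]) := by simp [od, map_ofNat]
  have hog2 : C (od 2) = (6 : ℝ[X]) := by simp [od, map_ofNat]
  have hog3 : C (od 3) = (5 : ℝ[X]) := by simp [od, map_ofNat]
  have hog4 : C (od 4) = (6 : ℝ[X]) := by simp [od, map_ofNat]
  have hog5 : C (od 5) = (3 : ℝ[X]) := by simp [od, map_ofNat]
  have hog6 : C (od 6) = (6 : ℝ[X]) := by simp [od, map_ofNat]
  -- unroll the continuant from the lower-right corner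
  have hD0 : (Matrix.of fun i j : Fin 0 => f (8 + i) (8 + j)).det = 1 := det_of_shift_zero f 8
  have hD1 : (Matrix.of fun i j : Fin 1 => f (7 + i) (7 + j)).det = (-6 : ℝ[X]) := by
    rw [det_of_shift_one, hdd 7, hdg7]
  have hD2 : (Matrix.of fun i j : Fin 2 => f (6 + i) (6 + j)).det = (36 - 36 * X ^ 2 : ℝ[X]) := by
    rw [det_of_shift_succ_succ f hf 0 6 7 8 rfl rfl, hD1, hD0, hdd 6, hdo 6 7 rfl, hod 6 7 rfl, hdg6, hog6]
    ring
  have hD3 : (Matrix.of fun i j : Fin 3 => f (5 + i) (5 + j)).det = (216 - 162 * X ^ 2 : ℝ[X]) := by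
    rw [det_of_shift_succ_succ f hf 1 5 6 7 rfl rfl, hD2, hD1, hdd 5, hdo 5 6 rfl, hod 5 6 rfl, hdg5, hog5]
    ring
  have hD4 : (Matrix.of fun i j : Fin 4 => f (4 + i) (4 + j)).det = (-1296 - 324 * X ^ 2 + 1296 * X ^ 4 : ℝ[X]) := by
    rw [det_of_shift_succ_succ f hf 2 4 5 6 rfl rfl, hD3, hD2, hdd 4, hdo 4 5 rfl, hod 4 5 rfl, hdg4, hog4]
    ring
  have hD5 : (Matrix.of fun i j : Fin 5 => f (3 + i) (3 + j)).det = (7776 - 3456 * X ^ 2 - 3726 * X ^ 4 : ℝ[X]) := by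
    rw [det_of_shift_succ_succ f hf 3 3 4 5 rfl rfl, hD4, hD3, hdd 3, hdo 3 4 rfl, hod 3 4 rfl, hdg3, hog3]
    ring
  have hD6 : (Matrix.of fun i j : Fin 6 => f (2 + i) (2 + j)).det =
      (46656 + 25920 * X ^ 2 - 10692 * X ^ 4 - 46656 * X ^ 6 : ℝ[X]) := by
    rw [det_of_shift_succ_succ f hf 4 2 3 4 rfl rfl, hD5, hD4, hdd 2, hdo 2 3 rfl, hod 2 3 rfl, hdg2, hog2]
    ring
  have hD7 : (Matrix.of fun i j : Fin 7 => f (1 + i) (1 + j)).det =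
      (279936 + 85536 * X ^ 2 - 33048 * X ^ 4 - 246402 * X ^ 6 : ℝ[X]) := by
    rw [det_of_shift_succ_succ f hf 5 1 2 3 rfl rfl, hD6, hD5, hdd 1, hdo 1 2 rfl, hod 1 2 rfl, hdg1, hog1]
    ring
  have hD8 : (Matrix.of fun i j : Fin 8 => f (0 + i) (0 + j)).det =
      (1679616 - 1166400 * X ^ 2 - 1131408 * X ^ 4 - 1093500 * X ^ 6 + 1679616 * X ^ 8 : ℝ[X]) := by
    rw [det_of_shift_succ_succ f hf 6 0 1 2 rfl rfl, hD7, hD6, hdd 0, hdo 0 1 rfl, hod 0 1 rfl, hdg0, hog0]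
    ring
  rw [hD8]
  simp only [map_ofNat]

/-- the coefficients of the witness determinant: `coeff k = 6⁸` at `k = 0, 8`, the three negative interior coefficients, `0` elsewhere.
[bookkeeping] -/
theorem coeff_cancellationWitness (k : ℕ) :
    (C 1679616 - C 1166400 * X ^ 2 - C 1131408 * X ^ 4 - C 1093500 * X ^ 6 + C 1679616 * X ^ 8 : ℝ[X]).coeff k =
      if k = 0 then 1679616 else if k = 2 then -1166400 else if k = 4 then -1131408 else if k = 6 then -1093500
        else if k = 8 then 1679616 else 0 := by
  simp only [coeff_add, coeff_sub, coeff_C_mul, coeff_X_pow, coeff_C]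
  by_cases h0 : k = 0
  · subst h0; norm_num
  by_cases h2 : k = 2
  · subst h2; norm_num
  by_cases h4 : k = 4
  · subst h4; norm_num
  by_cases h6 : k = 6
  · subst h6; norm_num
  by_cases h8 : k = 8
  · subst h8; norm_num
  simp [h0, h2, h4, h6, h8]

/-- `natDegree` and `leadingCoeff` of the witness determinant. [bookkeeping] -/
theorem natDegree_cancellationWitness :
    (C 1679616 - C 1166400 * X ^ 2 - C 1131408 * X ^ 4 - C 1093500 * X ^ 6 + C 1679616 * X ^ 8 : ℝ[X]).natDegree = 8 ∧
    (C 1679616 - C 1166400 * X ^ 2 - C 1131408 * X ^ 4 - C 1093500 * X ^ 6 + C 1679616 * X ^ 8 : ℝ[X]).leadingCoeff = 1679616 := by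
  have hle : (C 1679616 - C 1166400 * X ^ 2 - C 1131408 * X ^ 4 - C 1093500 * X ^ 6 + C 1679616 * X ^ 8 : ℝ[X]).natDegree ≤ 8 := by
    rw [Polynomial.natDegree_le_iff_coeff_eq_zero]
    intro N hN
    rw [coeff_cancellationWitness]
    have h0 : N ≠ 0 := by omega
    have h2 : N ≠ 2 := by omega
    have h4 : N ≠ 4 := by omega
    have h6 : N ≠ 6 := by omega
    have h8 : N ≠ 8 := by omega
    simp [h0, h2, h4, h6, h8]
  have h8 : (C 1679616 - C 1166400 * X ^ 2 - C 1131408 * X ^ 4 - C 1093500 * X ^ 6 + C 1679616 * X ^ 8 : ℝ[X]).coeff 8 = 1679616 := by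
    rw [coeff_cancellationWitness]; norm_num
  have hdeg : (C 1679616 - C 1166400 * X ^ 2 - C 1131408 * X ^ 4 - C 1093500 * X ^ 6 + C 1679616 * X ^ 8 : ℝ[X]).natDegree = 8 :=
    Polynomial.natDegree_eq_of_le_of_coeff_ne_zero hle (by rw [h8]; norm_num)
  refine ⟨hdeg, ?_⟩
  rw [Polynomial.leadingCoeff, hdeg, h8]

/-- **CANCELLATION-BORN ZEROS (kernel).**  A STATIC symmetric tridiagonal `8 × 8` matrix of monomials `C (c i j) · X ^ (e i j)` (`c`, `e`
symmetric, `c = 0` off the band; format `(8, 2)`: exponent `0` on the diagonal, `1` off it) whose determinant `p` has positive extreme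
coefficients `p.coeff 0 = p.leadingCoeff (= 6⁸)`, EVERY NEGATIVE COEFFICIENT STRICTLY BELOW THE CHORD of the extreme ones
(`|p_k| ^ deg < p_0 ^ (deg − k) · lc ^ k` — so the upper Newton polygon carries no sign change: signed Newton count `0`), and nevertheless at
least TWO distinct positive zeros.  Witness: `A + X·B`, `A = diag(6,6,6,−6,−6,6,−6,−6)`, `B` symmetric off-diagonal `(6,3,6,5,6,3,6)`.
[folklore: continuant + IVT; data of this seat] -/
theorem exists_staticTridiagonal_cancellationBorn :
    ∃ (c : Fin 8 → Fin 8 → ℝ) (e : Fin 8 → Fin 8 → ℕ), (∀ i j, c i j = c j i) ∧ (∀ i j, e i j = e j i) ∧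
      (∀ i j : Fin 8, (i : ℕ) + 1 < j ∨ (j : ℕ) + 1 < i → c i j = 0) ∧
      (0 < (Matrix.det (Matrix.of fun i j => C (c i j) * (X : ℝ[X]) ^ e i j)).coeff 0 ∧
        0 < (Matrix.det (Matrix.of fun i j => C (c i j) * (X : ℝ[X]) ^ e i j)).leadingCoeff ∧
        (∀ k : ℕ, (Matrix.det (Matrix.of fun i j => C (c i j) * (X : ℝ[X]) ^ e i j)).coeff k < 0 →
          |(Matrix.det (Matrix.of fun i j => C (c i j) * (X : ℝ[X]) ^ e i j)).coeff k| ^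
              (Matrix.det (Matrix.of fun i j => C (c i j) * (X : ℝ[X]) ^ e i j)).natDegree <
            (Matrix.det (Matrix.of fun i j => C (c i j) * (X : ℝ[X]) ^ e i j)).coeff 0 ^
                ((Matrix.det (Matrix.of fun i j => C (c i j) * (X : ℝ[X]) ^ e i j)).natDegree - k) *
              (Matrix.det (Matrix.of fun i j => C (c i j) * (X : ℝ[X]) ^ e i j)).leadingCoeff ^ k) ∧
        2 ≤ ((Matrix.det (Matrix.of fun i j => C (c i j) * (X : ℝ[X]) ^ e i j)).roots.toFinset.filter
          (fun t : ℝ => 0 < t)).card) := by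
  refine ⟨fun i j => if (i : ℕ) = j then (if (i : ℕ) = 3 ∨ (i : ℕ) = 4 ∨ (i : ℕ) = 6 ∨ (i : ℕ) = 7 then (-6 : ℝ) else 6)
      else if (j : ℕ) = i + 1 then (if (i : ℕ) = 1 ∨ (i : ℕ) = 5 then (3 : ℝ) else if (i : ℕ) = 3 then 5 else 6)
      else if (i : ℕ) = j + 1 then (if (j : ℕ) = 1 ∨ (j : ℕ) = 5 then (3 : ℝ) else if (j : ℕ) = 3 then 5 else 6)
      else 0,
    fun i j => if (i : ℕ) = j then 0 else 1, ?_, ?_, ?_, ?_⟩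
  · intro i j; fin_cases i <;> fin_cases j <;> simp
  · intro i j
    by_cases h : (i : ℕ) = j
    · simp [h]
    · have h' : (j : ℕ) ≠ i := fun h'' => h h''.symm
      simp [h, h']
  · intro i j hij
    have h1 : (i : ℕ) ≠ j := by omega
    have h2 : (j : ℕ) ≠ i + 1 := by omega
    have h3 : (i : ℕ) ≠ j + 1 := by omega
    simp only [h1, h2, h3, if_false]
  · rw [det_cancellationWitness]
    obtain ⟨hdeg, hlc⟩ := natDegree_cancellationWitness
    refine ⟨?_, ?_, ?_, ?_⟩
    · rw [coeff_cancellationWitness]; norm_num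
    · rw [hlc]; norm_num
    · intro k hk
      rw [coeff_cancellationWitness] at hk
      rw [hdeg, hlc, coeff_cancellationWitness, coeff_cancellationWitness]
      by_cases h0 : k = 0
      · subst h0; norm_num at hk
      by_cases h2 : k = 2
      · subst h2; norm_num
      by_cases h4 : k = 4
      · subst h4; norm_num
      by_cases h6 : k = 6
      · subst h6; norm_num
      by_cases h8 : k = 8
      · subst h8; norm_num at hk
      simp [h0, h2, h4, h6, h8] at hk
    · -- two positive zeros: `p(1/2) > 0`, `p(1) < 0`, `p(2) > 0`
      let τ : Fin 3 → ℝ := fun k => (2 : ℝ) ^ (k : ℕ) / 2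
      have hτ : StrictMono τ := by
        rw [Fin.strictMono_iff_lt_succ]
        intro i; fin_cases i <;> norm_num [τ]
      have hτpos : ∀ j, 0 < τ j := by
        intro j; fin_cases j <;> norm_num [τ]
      refine Summit.ValiantsHypothesis.ValiantsHypothesis.Theorems.SymmetroidDescartes.le_card_posRoots_of_alternating _ 2 τ hτ
        hτpos fun j => ?_
      fin_cases j <;> simp [τ, eval_add, eval_sub, eval_mul, eval_pow, eval_C, eval_X] <;> norm_num

/-- **THE ENVELOPE-COUNT LAW IS FALSE (kernel, `c ≤ 1`).**  It is NOT the case that every static symmetric tridiagonal matrix of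
monomials whose determinant `p` has positive extreme coefficients and all its negative coefficients strictly below the chord of the extreme
ones (hence an upper Newton polygon without sign change) has at most ONE positive determinant zero.  A fortiori «real count ≤ signed
Newton count + c» fails for `c = 0, 1` on the static tridiagonal sector (block sums make it fail for every `c`: located, module docstring).
[corollary] -/
theorem not_envelopeCountLaw_one :
    ¬ (∀ (m : ℕ) (c : Fin m → Fin m → ℝ) (e : Fin m → Fin m → ℕ), (∀ i j, c i j = c j i) → (∀ i j, e i j = e j i) →
        (∀ i j : Fin m, (i : ℕ) + 1 < j ∨ (j : ℕ) + 1 < i → c i j = 0) →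
        0 < (Matrix.det (Matrix.of fun i j => C (c i j) * (X : ℝ[X]) ^ e i j)).coeff 0 →
        0 < (Matrix.det (Matrix.of fun i j => C (c i j) * (X : ℝ[X]) ^ e i j)).leadingCoeff →
        (∀ k : ℕ, (Matrix.det (Matrix.of fun i j => C (c i j) * (X : ℝ[X]) ^ e i j)).coeff k < 0 →
          |(Matrix.det (Matrix.of fun i j => C (c i j) * (X : ℝ[X]) ^ e i j)).coeff k| ^
              (Matrix.det (Matrix.of fun i j => C (c i j) * (X : ℝ[X]) ^ e i j)).natDegree <
            (Matrix.det (Matrix.of fun i j => C (c i j) * (X : ℝ[X]) ^ e i j)).coeff 0 ^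
                ((Matrix.det (Matrix.of fun i j => C (c i j) * (X : ℝ[X]) ^ e i j)).natDegree - k) *
              (Matrix.det (Matrix.of fun i j => C (c i j) * (X : ℝ[X]) ^ e i j)).leadingCoeff ^ k) →
        ((Matrix.det (Matrix.of fun i j => C (c i j) * (X : ℝ[X]) ^ e i j)).roots.toFinset.filter
          (fun t : ℝ => 0 < t)).card ≤ 1) := by
  intro h
  obtain ⟨c, e, hc, he, hband, h0, hlc, hchord, h2⟩ := exists_staticTridiagonal_cancellationBorn
  have := h 8 c e hc he hband h0 hlc hchord
  omega

end Summit.ValiantsHypothesis.ValiantsHypothesis.Theorems.KPlusLogSqLaw.TridiagonalSector
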